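import Summits.ABC.ABC.Theorems.FeketeScalesScaleSubmultiplicativityEnvelopeWitnesses
import Literature.Barriers.ABC.EpsilonCannotBeDroppedHolds

/-!
# Crux `ScaleSubmultiplicativity` (stmt-ABC-2160): witness saturation, II — the floor `θ = 1/2`

Companion of `FeketeScalesScaleSubmultiplicativityEnvelopeWitnesses.lean`, which shows that the crux of route
`FeketeScales` (ABC/ABC) proved with ENVELOPE witnesses (`cᵢ ≤ e^B Rᵢ exp((log Rᵢ)^θ)`) is the pointwise sub-power
slack `c < rad · exp(A (log rad)^θ)` with the same exponent.  Here: below `θ = 1/2` that form is FALSE outright.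

* `ScaleSubmultiplicativity.infinite_bursts_of_lt_half` / `ScaleSubmultiplicativity.not_subpowerSlack_of_lt_half` —
  for every `τ < 1/2` and every `A` infinitely many abc triples have `c > rad · exp(A (log rad)^τ)`, so no sub-power
  slack with exponent `τ < 1/2` holds for all abc triples: Stewart–Tijdeman's pigeonhole families
  (`Literature.Barriers.ABC.EpsilonCannotBeDropped_holds`, infinitely many abc triples with
  `c > rad · exp((4-δ)√(log rad)/log log rad)`) beat it;
* `ScaleSubmultiplicativity.not_envelopeWitnesses_of_lt_half` — hence the crux with envelope witnesses of exponent
  `θ ∈ [0, 1/2)` is false: no proof of stmt-ABC-2160 by certified (envelope) witnesses exists below `θ = 1/2`, while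
  on `[1/2, 1)` such a proof is a proof of Robert–Stewart–Tenenbaum-upper-lite (part I).  The crux itself (any
  `θ < 1`, arbitrary witnesses) is untouched.

Kernel facts attached to the crux (`--supports stmt-ABC-2160`); no bearing on its truth.  The growth comparison and
the refutation are adapted from the planner sketch `Cruxes/Target/SketchIdeator2.lean` (`eventually_slack_le_ST`,
`not_subPowerSlack_of_lt_half`; crux workfiles are not importable from `Theorems/`).
Sources: [StewartTijdeman1986, Theorem 2]; [BombieriGubler2006, Thm. 12.4.6]; [RobertStewartTenenbaum2014, §1].
-/

-- `Summit.<Summit>.<Problem>` is the mandated summit-side namespace (CONVENTIONS §2); for the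
-- single-conjunct summit `ABC` the two coincide, so the duplicate `ABC.ABC` is deliberate.
set_option linter.dupNamespace false

namespace Summit.ABC.ABC.Theorems

open Literature.NumberTheory.DiophantineGeometry
open Summit.ABC.ABC.Theses.FeketeScales
open ScaleSubmultiplicativity.EnvelopeWitnesses

namespace ScaleSubmultiplicativity.EnvelopeWitnesses

/-- Growth comparison: for `τ < 1/2`, any real `A` and any `κ > 0`, eventually in `k : ℕ` one has
`A (log k)^τ ≤ κ √(log k) / log log k` (with `A' := 2A/κ`, `s := (1/2 - τ)/2`: `log L ≤ L^s/s` and `L^s ≥ |A'|/(2s)`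
for `L = log k` large give `A' L^τ log L ≤ 2√L`).  [folklore] -/
-- the case `κ = 2` is adapted from Cruxes/Target/SketchIdeator2.lean (`eventually_slack_le_ST`, planner sketch,
-- not importable from `Theorems/`)
theorem eventually_slack_le_mul_sqrt_div_loglog {τ : ℝ} (hτ : τ < 1 / 2) (A : ℝ) {κ : ℝ} (hκ : 0 < κ) :
    ∃ K : ℕ, ∀ k : ℕ, K ≤ k →
      A * Real.log (k : ℝ) ^ τ ≤ κ * Real.sqrt (Real.log (k : ℝ)) / Real.log (Real.log (k : ℝ)) := by
  set A' : ℝ := 2 * A / κ with hA'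
  set s : ℝ := (1 / 2 - τ) / 2 with hs
  have hs0 : 0 < s := by rw [hs]; linarith
  -- threshold in `L = log k`
  set L₀ : ℝ := (|A'| / (2 * s)) ^ (1 / s) with hL₀
  have hL₀0 : 0 ≤ L₀ := Real.rpow_nonneg (div_nonneg (abs_nonneg A') (by positivity)) _
  set Lm : ℝ := max L₀ (Real.exp 1) with hLm
  refine ⟨⌈Real.exp Lm⌉₊, fun k hk => ?_⟩
  have hk1 : Real.exp Lm ≤ (k : ℝ) := (Nat.le_ceil _).trans (by exact_mod_cast hk)
  have hk0 : (0 : ℝ) < k := (Real.exp_pos _).trans_le hk1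
  set L : ℝ := Real.log (k : ℝ) with hL
  have hLm_le : Lm ≤ L := by rw [hL, Real.le_log_iff_exp_le hk0]; exact hk1
  have hLe : Real.exp 1 ≤ L := (le_max_right _ _).trans hLm_le
  have hL1 : 1 < L := lt_of_lt_of_le (by linarith [Real.add_one_lt_exp (one_ne_zero)]) hLe
  have hL0 : 0 < L := by linarith
  have hlogL1 : 1 ≤ Real.log L := by
    rw [Real.le_log_iff_exp_le hL0]; exact hLe
  have hlogL0 : 0 < Real.log L := by linarith
  -- `|A'| L^τ log L ≤ 2 √L`
  have key : |A'| * L ^ τ * Real.log L ≤ 2 * Real.sqrt L := by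
    have hlog : Real.log L ≤ L ^ s / s := Real.log_le_rpow_div hL0.le hs0
    have hLs : |A'| / (2 * s) ≤ L ^ s := by
      have h1 : L₀ ≤ L := (le_max_left _ _).trans hLm_le
      calc |A'| / (2 * s) = L₀ ^ s := by
            rw [hL₀, one_div, Real.rpow_inv_rpow (div_nonneg (abs_nonneg A') (by positivity)) hs0.ne']
        _ ≤ L ^ s := Real.rpow_le_rpow hL₀0 h1 hs0.le
    have hLτ : 0 ≤ L ^ τ := Real.rpow_nonneg hL0.le _
    have hsqrt : Real.sqrt L = L ^ (τ + s) * L ^ s := by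
      rw [Real.sqrt_eq_rpow, ← Real.rpow_add hL0]; congr 1; rw [hs]; ring
    calc |A'| * L ^ τ * Real.log L ≤ |A'| * L ^ τ * (L ^ s / s) :=
          mul_le_mul_of_nonneg_left hlog (mul_nonneg (abs_nonneg A') hLτ)
      _ = (|A'| / (2 * s)) * (L ^ τ * L ^ s) * 2 := by field_simp
      _ ≤ L ^ s * (L ^ τ * L ^ s) * 2 :=
          mul_le_mul_of_nonneg_right (mul_le_mul_of_nonneg_right hLs (by positivity)) (by norm_num)
      _ = 2 * (L ^ (τ + s) * L ^ s) := by rw [Real.rpow_add hL0]; ring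
      _ = 2 * Real.sqrt L := by rw [hsqrt]
  have hA2 : A' * L ^ τ * Real.log L ≤ 2 * Real.sqrt L :=
    le_trans (mul_le_mul_of_nonneg_right
      (mul_le_mul_of_nonneg_right (le_abs_self A') (Real.rpow_nonneg hL0.le _)) hlogL0.le) key
  -- scale by `κ/2`
  have hAκ : A * L ^ τ * Real.log L ≤ κ * Real.sqrt L := by
    have h := mul_le_mul_of_nonneg_left hA2 (le_of_lt (half_pos hκ))
    have e1 : κ / 2 * (A' * L ^ τ * Real.log L) = A * L ^ τ * Real.log L := by
      rw [hA']; field_simp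
    have e2 : κ / 2 * (2 * Real.sqrt L) = κ * Real.sqrt L := by ring
    rwa [e1, e2] at h
  rw [le_div_iff₀ hlogL0]
  exact hAκ

end ScaleSubmultiplicativity.EnvelopeWitnesses

/-- **Exponent floor for the sub-power slack: bursts below `1/2`.**  For every `τ < 1/2` and every real `A`,
INFINITELY MANY abc triples satisfy `c > rad · exp(A (log rad)^τ)`: Stewart–Tijdeman's families
(`Literature.Barriers.ABC.EpsilonCannotBeDropped_holds`, with `δ = 2`: infinitely many abc triples with
`c > rad · exp(2√(log rad)/log log rad)`) beat `rad · exp(A (log rad)^τ)` beyond the threshold of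
`eventually_slack_le_mul_sqrt_div_loglog`, and `Literature.Barriers.ABC.infinite_lowerFamily_mono` discards the
finitely many smaller radicals.  [cite: StewartTijdeman1986, Theorem 2] [cite: BombieriGubler2006, Thm. 12.4.6] -/
theorem ScaleSubmultiplicativity.infinite_bursts_of_lt_half {τ : ℝ} (hτ : τ < 1 / 2) (A : ℝ) :
    {t : ℕ × ℕ × ℕ | IsABCTriple t.1 t.2.1 t.2.2 ∧
      ((rad t.1 t.2.1 t.2.2 : ℕ) : ℝ) * Real.exp (A * Real.log ((rad t.1 t.2.1 t.2.2 : ℕ) : ℝ) ^ τ)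
        < t.2.2}.Infinite := by
  obtain ⟨K, hK⟩ := eventually_slack_le_mul_sqrt_div_loglog hτ A two_pos
  have hST := Literature.Barriers.ABC.EpsilonCannotBeDropped_holds 2 two_pos
  exact Literature.Barriers.ABC.infinite_lowerFamily_mono
    (G₁ := fun k : ℕ => (k : ℝ) * Real.exp ((4 - 2) * Real.sqrt (Real.log (k : ℝ)) / Real.log (Real.log (k : ℝ))))
    (G₂ := fun k : ℕ => (k : ℝ) * Real.exp (A * Real.log (k : ℝ) ^ τ)) K
    (fun k hk => by
      have h := hK k hk
      apply mul_le_mul_of_nonneg_left _ (Nat.cast_nonneg k)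
      apply Real.exp_le_exp.mpr
      calc A * Real.log (k : ℝ) ^ τ ≤ 2 * Real.sqrt (Real.log (k : ℝ)) / Real.log (Real.log (k : ℝ)) := h
        _ = (4 - 2) * Real.sqrt (Real.log (k : ℝ)) / Real.log (Real.log (k : ℝ)) := by norm_num)
    hST

/-- **Exponent floor for the sub-power slack.**  No pointwise sub-power slack with exponent `τ < 1/2` holds for all
abc triples (one burst of `infinite_bursts_of_lt_half` suffices).  [cite: StewartTijdeman1986, Theorem 2] -/
-- cf. Cruxes/Target/SketchIdeator2.lean `not_subPowerSlack_of_lt_half` (planner sketch, not importable from `Theorems/`)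
theorem ScaleSubmultiplicativity.not_subpowerSlack_of_lt_half :
    ∀ τ A : ℝ, τ < 1 / 2 → ¬ ∀ a b c : ℕ, IsABCTriple a b c →
      (c : ℝ) < ((rad a b c : ℕ) : ℝ) * Real.exp (A * Real.log ((rad a b c : ℕ) : ℝ) ^ τ) := by
  intro τ A hτ hall
  obtain ⟨⟨a, b, c⟩, habc, hlt⟩ := (ScaleSubmultiplicativity.infinite_bursts_of_lt_half hτ A).nonempty
  exact lt_asymm hlt (hall a b c habc)

/-- **No envelope-witness proof of the crux exists below `θ = 1/2`.**  The crux of stmt-ABC-2160 with envelope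
witnesses of exponent `θ < 1/2` is FALSE: by `subpowerSlack_of_envelopeWitnesses_at` it would give the sub-power
slack with the same exponent `θ < 1/2`, refuted by Stewart–Tijdeman (`not_subpowerSlack_of_lt_half`).  (The crux
itself allows every `θ < 1` and is untouched; only the proof strategy is excluded on `[0, 1/2)`.)
[cite: StewartTijdeman1986, Theorem 2] [cite: BombieriGubler2006, Thm. 12.4.6] -/
theorem ScaleSubmultiplicativity.not_envelopeWitnesses_of_lt_half :
    ¬ ∃ θ : ℝ, 0 ≤ θ ∧ θ < 1 / 2 ∧ ∃ K : ℝ, 0 < K ∧ ∃ B : ℝ, ∃ R₀ : ℕ, ∀ R₁ R₂ : ℕ, R₀ ≤ R₁ → R₀ ≤ R₂ →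
      ∀ a b c : ℕ, IsABCTriple a b c → rad a b c ≤ R₁ * R₂ →
      ∃ a₁ b₁ c₁ a₂ b₂ c₂ : ℕ, IsABCTriple a₁ b₁ c₁ ∧ rad a₁ b₁ c₁ ≤ R₁ ∧
        (c₁ : ℝ) ≤ Real.exp B * (R₁ : ℝ) * Real.exp (Real.log (R₁ : ℝ) ^ θ) ∧
        IsABCTriple a₂ b₂ c₂ ∧ rad a₂ b₂ c₂ ≤ R₂ ∧
        (c₂ : ℝ) ≤ Real.exp B * (R₂ : ℝ) * Real.exp (Real.log (R₂ : ℝ) ^ θ) ∧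
        (c : ℝ) ≤ K * Real.exp (Real.log ((R₁ : ℝ) * R₂) ^ θ) * c₁ * c₂ := by
  rintro ⟨θ, hθ0, hθ, K, hK, B, R₀, hS⟩
  obtain ⟨A, hA⟩ := ScaleSubmultiplicativity.subpowerSlack_of_envelopeWitnesses_at hθ0 (by linarith) hK hS
  exact ScaleSubmultiplicativity.not_subpowerSlack_of_lt_half θ A hθ hA

end Summit.ABC.ABC.Theorems
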